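import Literature.NumberTheory.EllipticCurves.Sha
import Literature.NumberTheory.EllipticCurves.SubgroupSelmer
import Literature.NumberTheory.EllipticCurves.ZpExtension
import HarnessLib

/-!
# Local points over a subfield of `K̄_E`, finite-layer NORM maps, and the UNIVERSAL NORMS of an
# elliptic curve along a `ℤ_p`-extension, seen at a completion (definitions)

Topic `NumberTheory/EllipticCurves`. Definitions WITH BODIES (Mazur's objects; no `Prop`-valued
definition, nothing asserted) and their elementary API. Written for the cell `bsd-addord`
(run/shared/lean/pub/bsd-addord/, seat `bsd-addord-twist`, target T-ANOM, route R1 of TARGET.md §6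
S36″): Delbourgo's INTRINSIC local factor `[E(ℚ_p) : N_∞E(ℚ_p)]` of the algebraic `p`-adic BSD leading
term (J. Number Theory 95 (2002) p. 67 (iv), p. 69) is the index of the universal norms of `E(ℚ_p)`
from the local cyclotomic `ℤ_p`-tower; Mazur (Invent. Math. 18 (1972) §4 (4.33), (4.39)–(4.43), §5
Cor. 5.15) computes it for ordinary reduction. This file supplies the OBJECTS in the tree's currency
(`localPoints W E = E(K̄_E)` with its `Γ_E`-action, `Literature/…/Sha.lean`; `localSubgroup`,
`Literature/…/SubgroupSelmer.lean`; `ZpExtension.layerSubgroup`, `Literature/…/ZpExtension.lean`):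

* `localFixedPoints W E U` — the points of `E(K̄_E)` fixed by a subgroup `U ≤ Γ_E` (the points over
  the fixed field of `U`; for `U = Γ_E` these are the `E`-rational points, `StrictSelmerRankOne`'s
  Galois descent `exists_map_eq_of_forall_smul_localPoints_eq`);
* `localNorm W E h` — for `U' ≤ U` of finite index, the NORM (trace) `N_{U/U'} : E(K̄_E)^{U'} → E(K̄_E)^{U}`,
  `P ↦ Σ_{g ∈ U/U'} g • P` (Mazur §4 (4.1) p. 203: the norm mapping `N_{L/K} : A(L) → A(K)` for a finite
  extension `L/K` of local fields; (4.28) p. 216 for a formal group along a totally ramified `p`-power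
  extension);
* `localLayer E κ U n = U ⊓ (Γ_E → Γ_K)⁻¹(κ⁻¹(pⁿℤ_p))` — the `n`-th layer of the `ℤ_p`-extension `κ`
  of the ground field `K` seen from `U` (for `K = ℚ`, `E = ℚ_p`, `κ` cyclotomic, `U = Γ_{ℚ_p}`: the
  absolute Galois group of `ℚ_{p,n}`, the `n`-th layer of the cyclotomic `ℤ_p`-extension of `ℚ_p`, i.e.
  its unique subextension of degree `pⁿ` — for odd `p` the subfield of `ℚ_p(μ_{p^{n+1}})` fixed by the
  order-`(p - 1)` subgroup of `Gal(ℚ_p(μ_{p^{n+1}})/ℚ_p)`), of finite index in `U`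
  (`[Γ_K : κ⁻¹(pⁿℤ_p)] = pⁿ`, `ZpExtension.index_layerSubgroup`);
* `localUniversalNorms W E κ U = ⋂_n N_{U/U_n}(E(K̄_E)^{U_n})` — Mazur's subgroup of UNIVERSAL NORMS
  (§4 p. 217 (4.33) "`N_{L/K} Â(E)`", p. 226 "the subgroup of universal norms"; Delbourgo 2002 p. 61
  Remark: `N_∞E(K_{v_p}) := ∩_{K_{∞,v_p}/L/K_{v_p}} Norm_{L/K_{v_p}} E(L)`), an additive subgroup of
  `E(K̄_E)^U`, and its index `localUniversalNormIndex` (`AddSubgroup.index`, `0` if infinite).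

Nothing is claimed about these objects here (finiteness of the index, Mazur's evaluation `p^{2e_p}` at
a good ordinary prime, Delbourgo's intrinsic Theorem (B) are NAMED FACTS of their own files).

References: B. Mazur, Invent. Math. 18 (1972) 183–266, §4 (4.1), (4.28)–(4.33), Prop. 4.39, §5 (5.6),
Cor. 5.15 [Mazur1972Towers]; D. Delbourgo, J. Number Theory 95 (2002) 38–71, p. 61 (Remark), p. 67 (iv),
p. 69 [Delbourgo2002]; J.-P. Serre, *Local Fields*, VII §5–§7 (norm and trace on cohomology).
-/

noncomputable section

open scoped Classical

universe u

namespace Literature.NumberTheory.EllipticCurves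

open WeierstrassCurve Field

variable {K : Type u} [Field K] (W : WeierstrassCurve K) (E : Type u) [Field E] [Algebra K E]

/-! ### Points over the fixed field of a subgroup `U ≤ Γ_E` -/

/-- **`E(K̄_E)^U`**: the points of `E(K̄_E)` (`localPoints W E`) fixed by every element of the
subgroup `U ≤ Γ_E` — the points rational over the fixed field of `U` (for `U = Γ_{E'}`, `E'/E`
algebraic inside `K̄_E`, these are the `E'`-rational points). An additive subgroup.
[cite: Mazur1972Towers, §4 p. 216 (A(K), A(L) for L/K finite)] -/
def localFixedPoints (U : Subgroup (absoluteGaloisGroup E)) : AddSubgroup (localPoints W E) where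
  carrier := {P | ∀ σ ∈ U, σ • P = P}
  zero_mem' := fun σ _ ↦ smul_zero σ
  add_mem' := by
    intro P Q hP hQ σ hσ
    rw [smul_add, hP σ hσ, hQ σ hσ]
  neg_mem' := by
    intro P hP σ hσ
    rw [smul_neg, hP σ hσ]

variable {W E}

/-- Membership in `localFixedPoints` (definitional). [cite: Mazur1972Towers, §4 p. 216 (A(K), A(L))] -/
theorem mem_localFixedPoints_iff {U : Subgroup (absoluteGaloisGroup E)} {P : localPoints W E} :
    P ∈ localFixedPoints W E U ↔ ∀ σ ∈ U, σ • P = P :=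
  Iff.rfl

/-- `localFixedPoints` is antitone in the subgroup: a bigger group fixes fewer points (`A(K) ⊆ A(L)`
for `K ⊆ L`). [cite: Mazur1972Towers, §4 p. 216 (A(K) ⊆ A(L))] -/
theorem localFixedPoints_antitone {U U' : Subgroup (absoluteGaloisGroup E)} (h : U' ≤ U) :
    localFixedPoints W E U ≤ localFixedPoints W E U' :=
  fun _ hP σ hσ ↦ hP σ (h hσ)

/-- A point fixed by `U'` is moved by `g ∈ Γ_E` to a point fixed by `g U' g⁻¹`; in particular for
`U' ⊴ U` and `g ∈ U` the translate `g • P` is again `U'`-fixed. Here only the coset-invariance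
needed for the norm: `g • P` depends on `g` through `g U'`. [cite: Mazur1972Towers, §4 (4.1) p. 203 (the norm N_{L/K})] -/
theorem smul_eq_smul_of_inv_mul_mem {U' : Subgroup (absoluteGaloisGroup E)} {P : localPoints W E}
    (hP : P ∈ localFixedPoints W E U') {a b : absoluteGaloisGroup E} (hab : a⁻¹ * b ∈ U') :
    b • P = a • P := by
  have h := hP (a⁻¹ * b) hab
  calc b • P = (a * (a⁻¹ * b)) • P := by rw [mul_inv_cancel_left]
    _ = a • ((a⁻¹ * b) • P) := mul_smul _ _ _
    _ = a • P := by rw [h]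

/-! ### The norm `N_{U/U'}` for `U' ≤ U` of finite index -/

section Norm

variable (U : Subgroup (absoluteGaloisGroup E)) {U' : Subgroup (absoluteGaloisGroup E)}

/-- The summand of the norm: `g (U ∩ U') ↦ g • P` on the left cosets of `U ∩ U'` in `U`, well
defined on a `U'`-fixed point `P` (`smul_eq_smul_of_inv_mul_mem`). [cite: Mazur1972Towers, §4 (4.1) p. 203] -/
def normSummand (P : localFixedPoints W E U') : U ⧸ U'.subgroupOf U → localPoints W E :=
  Quotient.lift (fun g : U ↦ ((g : absoluteGaloisGroup E)) • (P : localPoints W E)) (by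
    intro a b hab
    have hab' : a⁻¹ * b ∈ U'.subgroupOf U := QuotientGroup.leftRel_apply.mp hab
    rw [Subgroup.mem_subgroupOf, Subgroup.coe_mul, Subgroup.coe_inv] at hab'
    exact (smul_eq_smul_of_inv_mul_mem P.2 hab').symm)

/-- `normSummand` on a representative (definitional). [cite: Mazur1972Towers, §4 (4.1) p. 203] -/
theorem normSummand_mk (P : localFixedPoints W E U') (g : U) :
    normSummand U P (QuotientGroup.mk g : U ⧸ U'.subgroupOf U) =
      (g : absoluteGaloisGroup E) • (P : localPoints W E) :=
  rfl

/-- Left multiplication by `u ∈ U` permutes the summands: `u • normSummand P q = normSummand P (u • q)`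
(so the norm lands in the `U`-fixed points). [cite: Mazur1972Towers, §4 (4.1) p. 203 (N_{L/K} A(L) → A(K))] -/
theorem smul_normSummand (P : localFixedPoints W E U') (u : U) (q : U ⧸ U'.subgroupOf U) :
    (u : absoluteGaloisGroup E) • normSummand U P q = normSummand U P (u • q) := by
  induction q using QuotientGroup.induction_on with
  | H g =>
    rw [MulAction.Quotient.smul_mk, normSummand_mk, normSummand_mk, smul_eq_mul, Subgroup.coe_mul,
      mul_smul]

variable (U') [hfi : (U'.subgroupOf U).FiniteIndex]

/-- A `Fintype` structure on the finite coset space `U / (U ∩ U')`. [folklore] -/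
noncomputable instance fintypeQuotientSubgroupOf : Fintype (U ⧸ U'.subgroupOf U) :=
  Subgroup.fintypeQuotientOfFiniteIndex

/-- **The norm `N_{U/U'} : E(K̄_E)^{U'} → E(K̄_E)^{U}`**, `P ↦ Σ_{g ∈ U/(U ∩ U')} g • P`, for `U ∩ U'` of
finite index in `U` (used with `U' ≤ U`: Mazur's `N_{L/K} : A(L) → A(K)` for the finite extension
`L/K` of fixed fields). The sum is `U`-invariant because left multiplication by `u ∈ U` permutes the
cosets. [cite: Mazur1972Towers, §4 (4.1) p. 203 (the norm mapping N_{L/K} A(L) → A(K))] -/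
def localNorm : localFixedPoints W E U' →+ localFixedPoints W E U where
  toFun P := ⟨∑ q : U ⧸ U'.subgroupOf U, normSummand U P q, by
    intro σ hσ
    rw [Finset.smul_sum]
    calc ∑ q : U ⧸ U'.subgroupOf U, σ • normSummand U P q
        = ∑ q : U ⧸ U'.subgroupOf U, normSummand U P ((⟨σ, hσ⟩ : U) • q) :=
          Finset.sum_congr rfl fun q _ ↦ smul_normSummand U P ⟨σ, hσ⟩ q
      _ = ∑ q : U ⧸ U'.subgroupOf U, normSummand U P q :=
          Fintype.sum_equiv (MulAction.toPerm (⟨σ, hσ⟩ : U)) _ _ fun _ ↦ rfl⟩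
  map_zero' := by
    apply Subtype.ext
    simp only [AddSubgroup.coe_zero]
    refine Finset.sum_eq_zero fun q _ ↦ ?_
    induction q using QuotientGroup.induction_on with
    | H g => rw [normSummand_mk, ZeroMemClass.coe_zero, smul_zero]
  map_add' P Q := by
    apply Subtype.ext
    simp only [AddSubgroup.coe_add]
    rw [← Finset.sum_add_distrib]
    refine Finset.sum_congr rfl fun q _ ↦ ?_
    induction q using QuotientGroup.induction_on with
    | H g => rw [normSummand_mk, normSummand_mk, normSummand_mk, AddSubgroup.coe_add, smul_add]

/-- The norm as a sum over coset representatives. [cite: Mazur1972Towers, §4 (4.1) p. 203] -/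
theorem coe_localNorm_apply (P : localFixedPoints W E U') :
    ((localNorm (W := W) U U' P : localFixedPoints W E U) : localPoints W E) =
      ∑ q : U ⧸ U'.subgroupOf U, normSummand U P q :=
  rfl

end Norm

/-! ### The layers of a `ℤ_p`-extension of `K` seen from `E`, and the universal norms -/

section Tower

variable {p : ℕ} [Fact p.Prime] (E) (κ : ZpExtension K p) (U : Subgroup (absoluteGaloisGroup E))

/-- **The `n`-th layer of `κ` seen from `U ≤ Γ_E`**: `U_n = U ⊓ (Γ_E → Γ_K)⁻¹(κ⁻¹(pⁿ ℤ_p))`. For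
`K = ℚ`, `E = ℚ_p`, `κ` the cyclotomic `ℤ_p`-extension and `U = Γ_{E'}` (`E' = ℚ_p` or a finite
extension inside `ℚ̄_p`): the absolute Galois group of the compositum `E' · ℚ_{p,n}` of `E'` with the
completed `n`-th cyclotomic layer — Mazur's `K̂_n`, Delbourgo's `K_{v_p} F_{n,𝔭}`.
[cite: Mazur1972Towers, §4 p. 220 (L/K a Γ-extension, L_n its layers)] [cite: Delbourgo2002, p. 61 (Remark: K_{∞,v_p})] -/
def localLayer (n : ℕ) : Subgroup (absoluteGaloisGroup E) :=
  U ⊓ localSubgroup (κ.layerSubgroup n) E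

/-- `U_n ≤ U` (the layers lie over the base). [cite: Mazur1972Towers, §4 p. 220 (the layers L_n of the Γ-extension L/K)] -/
theorem localLayer_le (n : ℕ) : localLayer E κ U n ≤ U :=
  inf_le_left

/-- The layers decrease (`L_n ⊆ L_{n+1}`). [cite: Mazur1972Towers, §4 p. 220 (the tower L_n)] -/
theorem localLayer_antitone : Antitone (localLayer E κ U) :=
  fun _ _ hmn ↦ inf_le_inf_left _ (Subgroup.comap_mono (κ.layerSubgroup_antitone hmn))

/-- `U_0 = U` (`L_0 = K`: `κ⁻¹(ℤ_p) = Γ_K`). [cite: Mazur1972Towers, §4 p. 220 (L_0 = K)] -/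
theorem localLayer_zero : localLayer E κ U 0 = U := by
  rw [localLayer, ZpExtension.layerSubgroup_zero, localSubgroup_top, inf_top_eq]

/-- **`U_n` has finite index in `U`** (at most `pⁿ = [Γ_K : κ⁻¹(pⁿℤ_p)]`,
`ZpExtension.index_layerSubgroup`). [cite: Mazur1972Towers, §4 p. 220] -/
instance finiteIndex_localLayer_subgroupOf (n : ℕ) : ((localLayer E κ U n).subgroupOf U).FiniteIndex := by
  haveI : (κ.layerSubgroup n).FiniteIndex :=
    ⟨by rw [κ.index_layerSubgroup n]; exact pow_ne_zero n (Fact.out : p.Prime).ne_zero⟩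
  haveI hH : (localSubgroup (κ.layerSubgroup n) E).FiniteIndex := by
    refine ⟨?_⟩
    rw [localSubgroup_eq_comap, Subgroup.index_comap]
    haveI := Subgroup.isFiniteRelIndex_of_finiteIndex (H := κ.layerSubgroup n)
      (K := (resGal (K := K) E).toMonoidHom.range)
    exact Subgroup.relIndex_ne_zero
  rw [localLayer, Subgroup.inf_subgroupOf_left]
  infer_instance

/-- **The universal norms `N_∞ = ⋂_n N_{U/U_n}(E(K̄_E)^{U_n})`** of `E(K̄_E)^U` from the `ℤ_p`-tower
`κ` (Mazur: "the subgroup of universal norms", §4 (4.33) and p. 226; Delbourgo 2002 p. 61 Remark: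
`N_∞E(K_{v_p}) := ∩_{K_{∞,v_p}/L/K_{v_p}} Norm_{L/K_{v_p}} E(L)` — the norm groups decrease along the
tower, so the intersection over the layers `L = K_{v_p}F_{n,𝔭}` is the intersection over all finite
subextensions). An additive subgroup of `localFixedPoints W E U`; nothing asserted.
[cite: Mazur1972Towers, §4 (4.33) and §5 p. 226 (universal norms)] [cite: Delbourgo2002, p. 61 (Remark, N_∞E(K_{v_p}))] -/
def localUniversalNorms : AddSubgroup (localFixedPoints W E U) :=
  ⨅ n : ℕ, (localNorm (W := W) U (localLayer E κ U n)).range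

/-- Membership in the universal norms: `P` is a norm from every layer (definitional).
[cite: Mazur1972Towers, §4 (4.33) (universal norms N_{L/K})] -/
theorem mem_localUniversalNorms_iff (P : localFixedPoints W E U) :
    P ∈ localUniversalNorms E κ U (W := W) ↔
      ∀ n : ℕ, P ∈ (localNorm (W := W) U (localLayer E κ U n)).range := by
  rw [localUniversalNorms, AddSubgroup.mem_iInf]

/-- **The universal norm index `[E(K̄_E)^U : N_∞]`** (`AddSubgroup.index`; `0` when infinite). For
`K = ℚ`, `E = ℚ_p`, `κ` cyclotomic, `U = Γ_{ℚ_p}` this is Delbourgo's `[E(ℚ_p) : N_∞E(ℚ_p)]`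
(J. Number Theory 95 (2002) p. 67 (iv), p. 69), for `U = Γ_{K_{v_p}}` his `[E(K_{v_p}) : N_∞E(K_{v_p})]`
(p. 61), and Mazur's `#(A(K)/N_{L/K}A(L))` (Invent. Math. 18 (1972) (4.39)–(4.43), (5.6)). Nothing
asserted. [cite: Delbourgo2002, p. 67 (iv) and p. 69 ([E(ℚ_p) : N_∞E(ℚ_p)])] [cite: Mazur1972Towers, Prop. 4.39 and (5.6)] -/
def localUniversalNormIndex : ℕ :=
  (localUniversalNorms E κ U (W := W)).index

end Tower

end Literature.NumberTheory.EllipticCurves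

end
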